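import Mathlib
import HarnessLib
import Summits.HubbardSuperconductivity.HubbardSuperconductivity.Theorems.KLProgrammeKLRegimeEngineV8TowerExports
import Summits.HubbardSuperconductivity.HubbardSuperconductivity.Theorems.KLProgrammeKLRegimeEngineV8DefsG7
import Summits.HubbardSuperconductivity.HubbardSuperconductivity.Theorems.KLProgrammeKLRegimeEngineIsoTupleV17FDoor

/-!
# Route `KLProgramme` — ENGINE child gen 8 (stmt-HubbardSuperconductivity-20437 `KLRegimeEngineV17F2`), SKELETON v2 (plan g17 (R47)/(R47i), KL STATUS
# 2026-08-27 14:25Z): v2 internal export class #6 «iso fixed-tuple line» — the (E5-F)ₙ door's input (I) as a named Prop, its step Prop and its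
# deferred constants (cell gate-hubbard-kl, seat hubbard-kl-k3c2-p2 g8 = owner of (E5-F)ₙ and of this TEXT)

WHY ((R41b)/(R46)/(R47i)).  (E5-F)ₙ `IsoTupleL1AtV17F … n` (item text, rev 22) is closed by the door `isoTupleL1AtV17F_of_fixedTuple_le_linear_hist`
(`…EngineIsoTupleV17FDoor`) from ONE line the (b)-F tower must export at level `n` — the ISOTROPIC FIXED-TUPLE size of the scale-`n` one-shot quartic kernel
at every finer resolution, `≤ a·U + b·(Klam U)²` — plus value-lane data already in the history and a U-door `a + b·Klam²·U ≤ CF/2`.  The label-SUMMED public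
norms cannot supply that line (sector count inside) and class #1's table is anisotropic / prescription-summed, so (R47i) books it as its own INTERNAL class,
with the constants behind ONE `∃` + `dite` (the #7/#12 pattern of (R47b)) so that v2 is final whatever the tower's constants turn out to be:

* §1 **`IsoTupleLineAt L M a b P β U μ n`** := `hfix` VERBATIM: `∀ m ≥ n, ∀ Ω ∈ bgmSectorSet (klIsoFamily … (K_n) klE0 m) 4, ∀ x₁,
  fixedTupleL1 β 3 (klIsoKernelAt … (K_n) n m) Ω x₁ ≤ a·U + b·(P.Klam·U)²` (G-, Q-, R-free); `IsoTupleLineAt.mono`;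
  consumer **`isoTupleL1AtV17F_of_isoTupleLineAt_hist`** = the door, keyed on the Prop;
* §2 **`IsIsoPkg P e`** for `e = (a, b, u)`: `0 ≤ a`, `0 ≤ b`, the threshold `u r cc` POSITIVE and FITTING — `a + b·Klam²·(u r cc) ≤ klEngGeo7.CF/2` —
  so that below the package's own threshold the door's single constant condition holds (the trivial package `(0, 0, 1)` is admissible: `0 ≤ CF/2`);
* §3 the STEP Prop **`IsoTupleLineStep P R Q₀ a b u`**: for every `G` (`G.WF`), every raised `CR`-value `r ≥ Q₀.CR`, under the stub binders of the engine-flow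
  skeleton (doors `klEngC₃6`, `klEngU₀9`, `klEngL₃`, `klEngM₃`; `n ≤ nScales β + 1`, `IsKLRegime`) and below the step's own threshold `U ≤ u r cc`, the
  history `HistP klPredsV17F2 … G P (Q₀.withCR r) … 0 n`, `FrameOK … (K_n)`, the class-#1 exports `LevelsUExportAt … (klCU P R Q₀) … j` at every `j ≤ n`
  and the iso lines at every `j < n` ⟹ `IsoTupleLineAt … a b … n` (shape = p5's `LevelsUStep`; producer = the (b)-F tower's birth-level fixed-tuple
  invariant + the iso(m) ← aniso(n) single-tuple re-sectorisation lemma, k3c2-p2 lineage);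
* §4 the DEFERRED package `klIsoPkg P R Q₀` (`dite` over `∃ e, IsIsoPkg P e ∧ IsoTupleLineStep P R Q₀ e.1 e.2.1 e.2.2`, else `(0, 0, 1)`), its projections
  **`klE5a`**, **`klE5b`**, **`klE5u`**, the unconditional facts `klE5a_nonneg`, `klE5b_nonneg`, **`klE5u_pos`**, **`klE5_fit`**
  (`klE5a + klE5b·Klam²·(klE5u r cc) ≤ klEngGeo7.CF/2`), and **`isoTupleLineStep_klE5_of_exists` / `_of`** (`choose_spec`).
  DefsU10's U-door takes `min` with `klE5u P R (klEngQ7 P R) r cc` (k3c2-p1); the (c) v2 closer reads `IsoTupleLineAt … (klE5a …) (klE5b …) … n` from the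
  invariant and applies §1's consumer with `klE5_fit_of_le`.

Definitions with bodies + bookkeeping; nothing about the model is asserted; nothing asserts superconductivity.
-/

noncomputable section

namespace Summit.HubbardSuperconductivity.HubbardSuperconductivity.Theorems.KLRegimeSplit

set_option linter.dupNamespace false -- summit = problem name (single-conjunct summit), D-0017

open Real Finset Literature.MathematicalPhysics.QuantumLattice Literature.Probability.LatticeModels
open Summit.HubbardSuperconductivity.HubbardSuperconductivity.Theorems.KLProgrammeLegKernels
open Summit.HubbardSuperconductivity.HubbardSuperconductivity.Theorems.DispersionFlow
open Summit.HubbardSuperconductivity.HubbardSuperconductivity.Theorems.EngineV8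

/-! ## §1 The iso fixed-tuple line (class #6 text) -/

section Model

variable (L M : ℕ) [NeZero L] [NeZero M]

/-- **`IsoTupleLineAt L M a b P β U μ n`** — v2 internal export class #6: the ISOTROPIC FIXED-TUPLE size of the scale-`n` one-shot quartic kernel
`𝒱ₙ[Kₙ]` at every finer resolution `m ≥ n`, on every admissible iso 4-tuple and pinned point, is `≤ a·U + b·(Klam U)²` — the (E5-F)ₙ door's input (I)
verbatim. -/
def IsoTupleLineAt (a b : ℝ) (P : SplitConsts) (β U μ : ℝ) (n : ℕ) : Prop :=
  ∀ m : ℕ, n ≤ m → ∀ Ω ∈ bgmSectorSet L M (klIsoFamily L M β μ (klFlowFrameU L M β U μ n) klE0 m) 4, ∀ x₁ : SpaceTimeIdx L M,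
    fixedTupleL1 L M β 3 (klIsoKernelAt L M β U μ (klFlowFrameU L M β U μ n) n m) Ω x₁ ≤ a * U + b * (P.Klam * U) ^ 2

variable {L M}

/-- A larger pair of constants is still met (`0 ≤ U`). -/
theorem IsoTupleLineAt.mono {a a' b b' : ℝ} {P : SplitConsts} {β U μ : ℝ} {n : ℕ} (h : IsoTupleLineAt L M a b P β U μ n) (hU : 0 ≤ U)
    (ha : a ≤ a') (hb : b ≤ b') : IsoTupleLineAt L M a' b' P β U μ n := by
  intro m hm Ω hΩ x₁
  refine (h m hm Ω hΩ x₁).trans ?_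
  have h1 : a * U ≤ a' * U := mul_le_mul_of_nonneg_right ha hU
  have h2 : b * (P.Klam * U) ^ 2 ≤ b' * (P.Klam * U) ^ 2 := mul_le_mul_of_nonneg_right hb (sq_nonneg _)
  linarith

/-- **The (E5-F)ₙ door keyed on the class-#6 Prop** (`1 ≤ n`): `IsoTupleLineAt a b … n` + the stub's history + the CURRENT (E2″-F)ₙ + two bare-ball points
with `4⁻¹ < |q + q₃|_𝕋` + `R.Gfr 0·|U| ≤ klE0/32` + the accumulated-rows smallness + the single constant condition `a + b·Klam²·U ≤ CF/2`
⟹ `IsoTupleL1AtV17F … n` (= `isoTupleL1AtV17F_of_fixedTuple_le_linear_hist`). -/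
theorem isoTupleL1AtV17F_of_isoTupleLineAt_hist {G : GeoConsts} {P : SplitConsts} {Q : EngConsts} {R : RenConsts} {β U μ : ℝ}
    (hG : G.WF) (hP : P.WF) (hQ : Q.WF) (hR : R.WF) (hU : 0 < U) {n : ℕ} (hn1 : 1 ≤ n) (hn : n ≤ nScales β + 1) {a b : ℝ}
    (hline : IsoTupleLineAt L M a b P β U μ n) (hab : a + b * P.Klam ^ 2 * U ≤ G.CF / 2)
    (hhist : HistP klPredsV17F2 L M G P Q R β U μ 0 n) (hE2'' : PairValueIncrementAtV17F L M G P Q β U μ n)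
    {q q₃ : TorusSite 2 L} (hq : q ∈ klBall L μ 0) (hq₃ : q₃ ∈ klBall L μ 0) (hqq : 4⁻¹ < klTorusNorm L (q + q₃))
    (hUκ : R.Gfr 0 * |U| ≤ 1 / 32 * klE0)
    (hsmall : initDevBar G U + legDressBarQ2 G P Q U 0 4 +
        (3 * G.CF * (P.Klam * U) ^ 2 +
          ((G.cloc * P.Klam ^ 2 * (1 - (4 : ℝ) ^ (-G.θ))⁻¹ + 2 * Q.CR * P.Klam ^ 3 * |U|) * U ^ 2 + ∑ j ∈ range n, Q.CL β j / L) +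
            7 / 3 * (G.CF * (P.Klam * U) ^ 2) + 20 * (Q.CR * ((P.Klam * U) ^ 2 + (P.Klam * |U|) ^ 3)) +
              4 / 3 * (Q.CR * (P.Klam * U) ^ 2)) ≤ U / 2) :
    IsoTupleL1AtV17F L M G P β U μ n :=
  isoTupleL1AtV17F_of_fixedTuple_le_linear_hist hG hP hQ hR hU hn1 hn hline hab hhist hE2'' hq hq₃ hqq hUκ hsmall

end Model

/-! ## §2 Admissible packages: nonnegative constants, a positive threshold that FITS the door -/

/-- **`IsIsoPkg P (a, b, u)`**: `0 ≤ a`, `0 ≤ b`, and for every raised `CR`-value `r` and regime constant `cc` the threshold `u r cc` is positive and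
below it the door's constant condition holds: `a + b·Klam²·(u r cc) ≤ klEngGeo7.CF/2`. -/
def IsIsoPkg (P : SplitConsts) (e : ℝ × ℝ × (ℝ → ℝ → ℝ)) : Prop :=
  0 ≤ e.1 ∧ 0 ≤ e.2.1 ∧ ∀ r cc : ℝ, 0 < e.2.2 r cc ∧ e.1 + e.2.1 * P.Klam ^ 2 * e.2.2 r cc ≤ klEngGeo7.CF / 2

/-- The trivial package `(0, 0, 1)` is admissible (`0 ≤ klEngGeo7.CF`). -/
theorem isIsoPkg_zero (P : SplitConsts) : IsIsoPkg P (0, 0, fun _ _ => 1) := by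
  refine ⟨le_rfl, le_rfl, fun r cc => ⟨one_pos, ?_⟩⟩
  have hCF : 0 ≤ klEngGeo7.CF := klEngGeo7_wf.2.2.2.2.2.2.2.2.2.2.2.2.2.1
  simp only [zero_mul, add_zero]
  linarith

/-! ## §3 The step Prop -/

/-- **`IsoTupleLineStep P R Q₀ a b u`** — the producer's step for class #6: for every geometry package `G` (`G.WF`; read only through the history),
every raised `CR`-value `r ≥ Q₀.CR`, under the stub binders of the engine-flow skeleton and below the v1 door `klEngU₀9` AND the step's own threshold
`u r cc`, the history at `Q₀.withCR r`, the admissibility of `K_n`, the class-#1 exports (deferred table `klCU P R Q₀`) at every `j ≤ n` and the iso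
lines at every `j < n` give the iso line at `n` (at `n = 0` the line histories are empty; the scale-`0` line is the explicit grid computation of
`fixedTupleL1_klIsoKernelAt_zero_le_of_torusSum`). -/
def IsoTupleLineStep (P : SplitConsts) (R : RenConsts) (Q₀ : EngConsts) (a b : ℝ) (u : ℝ → ℝ → ℝ) : Prop :=
  ∀ G : GeoConsts, G.WF → ∀ r : ℝ, Q₀.CR ≤ r →
    ∀ cc : ℝ, 0 < cc → cc ≤ klEngC₃6 P R →
      ∀ μ ∈ klWindowC, ∀ U : ℝ, 0 < U → U ≤ klEngU₀9 P R cc → U ≤ u r cc →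
        ∀ β : ℝ, klBetaMin ≤ β → β ≤ Real.exp (cc / U ^ 2) →
          ∀ (L M : ℕ) [NeZero L] [NeZero M], klEngL₃ β U ≤ L → klEngM₃ β U L ≤ M →
            ∀ n : ℕ, n ≤ nScales β + 1 → IsKLRegime U cc (-(n : ℤ)) →
              HistP klPredsV17F2 L M G P (Q₀.withCR r) R β U μ 0 n →
                FrameOK R U (nScales β) μ (klFlowFrameU L M β U μ n) →
                  (∀ j ≤ n, LevelsUExportAt L M (klCU P R Q₀) P β U μ j) →
                    (∀ j < n, IsoTupleLineAt L M a b P β U μ j) →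
                      IsoTupleLineAt L M a b P β U μ n

/-! ## §4 The deferred constants `klE5a`, `klE5b`, `klE5u` -/

section Deferred

variable (P : SplitConsts) (R : RenConsts) (Q₀ : EngConsts)

/-- The deferred class-#6 package: SOME admissible `(a, b, u)` for which the step holds, if one exists, else the trivial package. -/
def klIsoPkg : ℝ × ℝ × (ℝ → ℝ → ℝ) :=
  open scoped Classical in
  if h : ∃ e : ℝ × ℝ × (ℝ → ℝ → ℝ), IsIsoPkg P e ∧ IsoTupleLineStep P R Q₀ e.1 e.2.1 e.2.2 then Classical.choose h else (0, 0, fun _ _ => 1)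

/-- **The deferred bare-part constant `klE5a P R Q₀`** of the iso line. -/
def klE5a : ℝ := (klIsoPkg P R Q₀).1

/-- **The deferred quadratic constant `klE5b P R Q₀`** of the iso line. -/
def klE5b : ℝ := (klIsoPkg P R Q₀).2.1

/-- **The deferred threshold `klE5u P R Q₀ r cc`** of the iso line (DefsU10's class-#6 `min` term). -/
def klE5u : ℝ → ℝ → ℝ := (klIsoPkg P R Q₀).2.2

/-- The deferred package is admissible (unconditionally). -/
theorem isIsoPkg_klIsoPkg : IsIsoPkg P (klIsoPkg P R Q₀) := by
  classical
  unfold klIsoPkg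
  split_ifs with h
  · exact (Classical.choose_spec h).1
  · exact isIsoPkg_zero P

/-- `0 ≤ klE5a`. -/
theorem klE5a_nonneg : 0 ≤ klE5a P R Q₀ := (isIsoPkg_klIsoPkg P R Q₀).1

/-- `0 ≤ klE5b`. -/
theorem klE5b_nonneg : 0 ≤ klE5b P R Q₀ := (isIsoPkg_klIsoPkg P R Q₀).2.1

/-- **`0 < klE5u r cc`** (unconditionally — the U-door stays positive). -/
theorem klE5u_pos (r cc : ℝ) : 0 < klE5u P R Q₀ r cc := ((isIsoPkg_klIsoPkg P R Q₀).2.2 r cc).1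

/-- **The FIT at the threshold**: `klE5a + klE5b·Klam²·(klE5u r cc) ≤ klEngGeo7.CF/2`. -/
theorem klE5_fit (r cc : ℝ) : klE5a P R Q₀ + klE5b P R Q₀ * P.Klam ^ 2 * klE5u P R Q₀ r cc ≤ klEngGeo7.CF / 2 :=
  ((isIsoPkg_klIsoPkg P R Q₀).2.2 r cc).2

/-- **The door's constant condition below the threshold**: `0 ≤ U ≤ klE5u r cc` ⟹ `klE5a + klE5b·Klam²·U ≤ klEngGeo7.CF/2`. -/
theorem klE5_fit_of_le {r cc U : ℝ} (hU : U ≤ klE5u P R Q₀ r cc) :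
    klE5a P R Q₀ + klE5b P R Q₀ * P.Klam ^ 2 * U ≤ klEngGeo7.CF / 2 := by
  have hb : 0 ≤ klE5b P R Q₀ * P.Klam ^ 2 := mul_nonneg (klE5b_nonneg P R Q₀) (sq_nonneg _)
  have h1 := mul_le_mul_of_nonneg_left hU hb
  linarith [klE5_fit P R Q₀ r cc]

variable {P R Q₀}

/-- **The step holds for the deferred package as soon as it holds for some admissible package.** -/
theorem isoTupleLineStep_klE5_of_exists (h : ∃ e : ℝ × ℝ × (ℝ → ℝ → ℝ), IsIsoPkg P e ∧ IsoTupleLineStep P R Q₀ e.1 e.2.1 e.2.2) :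
    IsoTupleLineStep P R Q₀ (klE5a P R Q₀) (klE5b P R Q₀) (klE5u P R Q₀) := by
  classical
  have hpkg : klIsoPkg P R Q₀ = Classical.choose h := by
    unfold klIsoPkg
    rw [dif_pos h]
  unfold klE5a klE5b klE5u
  rw [hpkg]
  exact (Classical.choose_spec h).2

/-- Packaging an explicit witness. -/
theorem isoTupleLineStep_klE5_of {a b : ℝ} {u : ℝ → ℝ → ℝ} (ha : 0 ≤ a) (hb : 0 ≤ b)
    (hu : ∀ r cc, 0 < u r cc ∧ a + b * P.Klam ^ 2 * u r cc ≤ klEngGeo7.CF / 2) (hs : IsoTupleLineStep P R Q₀ a b u) :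
    IsoTupleLineStep P R Q₀ (klE5a P R Q₀) (klE5b P R Q₀) (klE5u P R Q₀) :=
  isoTupleLineStep_klE5_of_exists ⟨(a, b, u), ⟨ha, hb, hu⟩, hs⟩

end Deferred

end Summit.HubbardSuperconductivity.HubbardSuperconductivity.Theorems.KLRegimeSplit

end
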